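import Literature.NumberTheory.EllipticCurves.QuadraticTwistLFunctionProofs
import Literature.NumberTheory.EllipticCurves.CuspFormTwistAtkinLehnerProofs
import Literature.NumberTheory.EllipticCurves.RootNumberAtkinLehnerTrustProofs
import Literature.NumberTheory.EllipticCurves.RootNumberAtkinLehnerSemistableProofs
import Literature.NumberTheory.EllipticCurves.BSDRootNumberPrimesEquivProofs
import HarnessLib

/-!
# Kellock–Dokchitser's Remark 2.2 at the additive primes of quadratic-twist type, proved

Let `E / ℚ` be an elliptic curve, `p ≥ 5` a prime of additive reduction such that the quadratic twist
`E' = E^{(p*)}`, `p* = (−1)^{(p−1)/2} p`, is semistable at `p` (i.e. `E` has potentially multiplicative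
reduction, or potentially good reduction with `e = 2`, at `p`: Rohrlich 1993, Prop. 2(iii) and the case
`e = 2` of (iv)), and assume `E` semistable at `2` and `3` and the Modularity Theorem
(`exists_isNewformOf`). Then the Atkin–Lehner eigenvalue at `p` of the newform `f` of `E` is the
local root number: `λ_p(f) = (−1/p) = W_p(E)` (`atkinLehnerEigenvalueAt_eq_localRootNumberAt_of_twist`).

Proof (all ingredients are theorems of the tree):
* `aₙ(E') = (n/p) aₙ(E)` for `p ∤ n` (`LFunction_quadraticTwist_pStar_apply`) and `aₙ(E) = 0` for
  `p ∣ n` (additive reduction at `p`), so the newform `f` of `E` has the `q`-expansion of the twist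
  `f'_χ` of the newform `f'` of `E'` by `χ = (·/p)` (`cuspCoeff_charTwist`), hence `f = f'_χ`;
* the level `N'` of `f'` divides `Mp` where `N_E = Mp²` (reduction types of `E'` and `E` agree away
  from `p`; `f_p(E') ≤ 1`), so `w_{p²} f'_χ = χ(−1) f'_χ` (`atkinLehnerEigenvalueAt_charTwist_of_eq`,
  Atkin–Lehner 1970 §6 / Atkin–Li 1978);
* `W_p(E) = (−1/p)` by Rohrlich's case list on the minimal model `(minimal model of E'_p)^{(p*)}`.

Consequently (`rootNumber_eq_algebraicRootNumber_of_exists_isNewformOf_of_twist`):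
**`w(E) = −∏_p W_p(E)` from the Modularity Theorem alone** for every elliptic curve over `ℚ` with no
additive reduction at `2, 3` all of whose additive primes are of quadratic-twist type — e.g. every
quadratic twist by `d` prime to `6` of a semistable curve. No new definitions, no named facts.

## References

* L. Cowland Kellock, V. Dokchitser, *Root numbers and parity phenomena*, Bull. LMS 55 (2023), Rem. 2.2.
* D. Rohrlich, *Variation of the root number in families of elliptic curves*, Compositio Math. 87
  (1993), Prop. 2.
* A. O. L. Atkin, W.-C. W. Li, *Twists of newforms and pseudo-eigenvalues of `W`-operators*,
  Invent. Math. 48 (1978), §3.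
* A. W. Knapp, *Elliptic Curves*, 1993, Thm. 9.27.
-/

noncomputable section

open scoped MatrixGroups Classical

open CongruenceSubgroup Literature.NumberTheory.EllipticCurves.ModularForms IsDedekindDomain
  IsDedekindDomain.HeightOneSpectrum NumberField Rat.HeightOneSpectrum

namespace Literature.NumberTheory.EllipticCurves.ModularForms

/-! ### The quadratic character `(·/p)` as a Dirichlet character with values in `ℂ` -/

section Character

variable (p : ℕ) [Fact p.Prime]

/-- The values of `(quadraticChar 𝔽_p) ⊗ ℂ` are the Legendre symbols. [folklore] -/
theorem quadraticChar_ringHomComp_apply (n : ℤ) :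
    (quadraticChar (ZMod p)).ringHomComp (Int.castRingHom ℂ) n = (legendreSym p n : ℂ) := by
  rw [MulChar.ringHomComp_apply, legendreSym]
  rfl

/-- `(·/p) ⊗ ℂ` at a natural number. [folklore] -/
theorem quadraticChar_ringHomComp_apply_natCast (n : ℕ) :
    (quadraticChar (ZMod p)).ringHomComp (Int.castRingHom ℂ) n = (legendreSym p n : ℂ) := by
  rw [← quadraticChar_ringHomComp_apply p n, Int.cast_natCast]

/-- `(·/p) ⊗ ℂ` is a quadratic character. [folklore] -/
theorem isQuadratic_quadraticChar_ringHomComp :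
    ((quadraticChar (ZMod p)).ringHomComp (Int.castRingHom ℂ)).IsQuadratic :=
  (quadraticChar_isQuadratic (ZMod p)).comp _

/-- `(·/p) ⊗ ℂ` is primitive for `p` odd (it is non-trivial and `p` is prime). [folklore] -/
theorem isPrimitive_quadraticChar_ringHomComp (hp2 : p ≠ 2) :
    DirichletCharacter.IsPrimitive ((quadraticChar (ZMod p)).ringHomComp (Int.castRingHom ℂ)) := by
  rw [DirichletCharacter.isPrimitive_def]
  have hdvd := DirichletCharacter.conductor_dvd_level
    ((quadraticChar (ZMod p)).ringHomComp (Int.castRingHom ℂ))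
  rcases (Nat.dvd_prime Fact.out).mp hdvd with h1 | h
  · exfalso
    have hone := DirichletCharacter.eq_one_iff_conductor_eq_one.mpr h1
    have hF : ringChar (ZMod p) ≠ 2 := by rwa [ZMod.ringChar_zmod_n]
    obtain ⟨a, ha⟩ := quadraticChar_exists_neg_one hF
    have hau : IsUnit a := by
      by_contra hau
      rw [MulChar.map_nonunit _ hau] at ha
      norm_num at ha
    have h2 := congrArg (fun χ : DirichletCharacter ℂ p ↦ χ a) hone
    simp only [MulChar.ringHomComp_apply, ha] at h2
    rw [← hau.unit_spec, MulChar.one_apply_coe] at h2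
    norm_num at h2
  · exact h

/-- `(−1/p) = χ₄(p)` for `(·/p) ⊗ ℂ`. [folklore] -/
theorem quadraticChar_ringHomComp_neg_one (hp2 : p ≠ 2) :
    (quadraticChar (ZMod p)).ringHomComp (Int.castRingHom ℂ) (-1) = (ZMod.χ₄ p : ℂ) := by
  have h := quadraticChar_ringHomComp_apply p (-1)
  rw [Int.cast_neg, Int.cast_one] at h
  rw [h, legendreSym.at_neg_one hp2]

end Character

/-! ### The modular core: a form with the `q`-expansion of a twist is the twist -/

section Modular

variable {p : ℕ} [Fact p.Prime] {M N N' : ℕ} [NeZero N] [NeZero N']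

/-- **`λ_p(f) = (−1/p)` for a form whose `q`-expansion is the `(·/p)`-twist of a form of level
dividing `Mp`, at level `N = Mp²`**: by the `q`-expansion principle `f` *is* the twist
(`cuspCoeff_charTwist`), whose Atkin–Lehner eigenvalue at `p` is `χ(−1)`
(`atkinLehnerEigenvalueAt_charTwist_of_eq`; Atkin–Lehner 1970, §6; Atkin–Li 1978, §3). [folklore] -/
theorem atkinLehnerEigenvalueAt_eq_χ₄_of_cuspCoeff_eq (hp2 : p ≠ 2) (hN : N = M * p ^ 2)
    (hpM : ¬ p ∣ M) (hN' : N' ∣ M * p) {f : CuspForm (Gamma0 N) 2} {f' : CuspForm (Gamma0 N') 2}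
    (hf0 : f ≠ 0)
    (hcoeff : ∀ n : ℕ, cuspCoeff f n = (legendreSym p n : ℂ) * cuspCoeff f' n) :
    atkinLehnerEigenvalueAt f p = (ZMod.χ₄ p : ℂ) := by
  haveI : NeZero M := ⟨fun h ↦ NeZero.ne N (by rw [hN, h, zero_mul])⟩
  have hNL : N' ∣ N := hN'.trans (hN ▸ ⟨p, by ring⟩)
  have hpL : p ^ 2 ∣ N := hN ▸ Dvd.intro_left M rfl
  set χ : DirichletCharacter ℂ p := (quadraticChar (ZMod p)).ringHomComp (Int.castRingHom ℂ) with hχ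
  have hq := isQuadratic_quadraticChar_ringHomComp p
  have hprim := isPrimitive_quadraticChar_ringHomComp p hp2
  have hfeq : f = charTwist N hNL hpL hq f' := by
    refine eq_of_forall_cuspCoeff_eq_gamma0 fun n ↦ ?_
    rw [cuspCoeff_charTwist N hNL hpL hq hprim f' n, hcoeff n, ← hχ, quadraticChar_ringHomComp_apply_natCast]
  rw [hfeq, atkinLehnerEigenvalueAt_charTwist_of_eq hN hpM hN' hNL hpL hq (hfeq ▸ hf0), ← hχ,
    quadraticChar_ringHomComp_neg_one p hp2]

end Modular

end Literature.NumberTheory.EllipticCurves.ModularForms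

/-! ### Reduction types at the place of `𝓞 ℚ` over `p` versus `ℤ_[p]` and the place of `ℤ` -/

namespace WeierstrassCurve

variable (W : WeierstrassCurve ℚ)

/-- `v`-indexed bridge for the finite places of `𝓞 ℚ`, multiplicative case: the `ℤ_[p]`-minimal model
of `W / ℚ_[p]` (`p = primesEquiv v`) has multiplicative reduction iff the chosen `𝓞_v`-minimal model
of `W / ℚ_v` has (same proof as the tree's `ℤ`-indexed
`hasMultiplicativeReductionAtPrime_primesEquiv_iff_hasMultiplicativeReductionAt`, with
`padicEquiv_mem_range_iff_ringOfIntegers`). [cite: SilvermanAEC2009, VII.5 Prop. 5.1(b) and VII.1 Prop. 1.3(b)] -/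
theorem hasMultiplicativeReductionAtPrime_iff_hasMultiplicativeReductionAt_ringOfIntegers [W.IsElliptic]
    (v : HeightOneSpectrum (𝓞 ℚ)) :
    (haveI := Fact.mk (primesEquiv v).2; W.HasMultiplicativeReductionAtPrime (primesEquiv v)) ↔
      W.HasMultiplicativeReductionAt v := by
  haveI := Fact.mk (primesEquiv v).2
  have he := padicEquiv_mem_range_iff_ringOfIntegers v
  have hW : (W.baseChange (v.adicCompletion ℚ)).map
      ((adicCompletion.padicEquiv v).toAlgEquiv.toRingEquiv :
        v.adicCompletion ℚ →+* ℚ_[primesEquiv v]) = W.baseChange ℚ_[primesEquiv v] := by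
    simp only [baseChange, map_map]
    exact congrArg W.map (Subsingleton.elim _ _)
  obtain ⟨C, hC⟩ : ∃ C : VariableChange (v.adicCompletion ℚ),
      W.localMinimalModel v = C • W.baseChange (v.adicCompletion ℚ) := ⟨_, rfl⟩
  obtain ⟨D, hD⟩ : ∃ D : VariableChange ℚ_[primesEquiv v],
      (W.baseChange ℚ_[primesEquiv v]).minimal ℤ_[primesEquiv v] =
        D • W.baseChange ℚ_[primesEquiv v] := ⟨_, rfl⟩
  haveI : ((W.localMinimalModel v).map
      ((adicCompletion.padicEquiv v).toAlgEquiv.toRingEquiv :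
        v.adicCompletion ℚ →+* ℚ_[primesEquiv v])).IsMinimal ℤ_[primesEquiv v] :=
    (isMinimal_map_iff _ he _).mpr inferInstance
  have hrel : (W.baseChange ℚ_[primesEquiv v]).minimal ℤ_[primesEquiv v] =
      (D * (C.map ((adicCompletion.padicEquiv v).toAlgEquiv.toRingEquiv :
        v.adicCompletion ℚ →+* ℚ_[primesEquiv v]))⁻¹) •
        (W.localMinimalModel v).map ((adicCompletion.padicEquiv v).toAlgEquiv.toRingEquiv :
          v.adicCompletion ℚ →+* ℚ_[primesEquiv v]) := by
    rw [hD, hC, ← map_variableChange, hW, mul_smul, inv_smul_smul]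
  haveI := W.isElliptic_localMinimalModel v
  have hΔ : ((W.localMinimalModel v).map ((adicCompletion.padicEquiv v).toAlgEquiv.toRingEquiv :
      v.adicCompletion ℚ →+* ℚ_[primesEquiv v])).Δ ≠ 0 := by
    rw [map_Δ]
    exact (map_ne_zero _).mpr (W.localMinimalModel v).isUnit_Δ.ne_zero
  change ((W.baseChange ℚ_[primesEquiv v]).minimal ℤ_[primesEquiv v]).HasMultiplicativeReduction
      ℤ_[primesEquiv v] ↔
    (W.localMinimalModel v).HasMultiplicativeReduction (v.adicCompletionIntegers ℚ)
  rw [hasMultiplicativeReduction_iff_of_isMinimal_of_eq_smul ℤ_[primesEquiv v] hrel hΔ,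
    hasMultiplicativeReduction_map_iff _ he]

/-- Additive reduction over `ℤ_[p]` ↔ at the place of `𝓞 ℚ` over `p` (trichotomy with the good and
multiplicative bridges). [folklore] -/
theorem hasAdditiveReduction_padic_iff_hasAdditiveReductionAt_ringOfIntegers [W.IsElliptic]
    (v : HeightOneSpectrum (𝓞 ℚ)) :
    (haveI := Fact.mk (primesEquiv v).2;
      ((W.baseChange ℚ_[primesEquiv v]).minimal ℤ_[primesEquiv v]).HasAdditiveReduction ℤ_[primesEquiv v]) ↔
      W.HasAdditiveReductionAt v := by
  haveI := Fact.mk (primesEquiv v).2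
  have hg := hasGoodReductionAtPrime_iff_hasGoodReductionAt_ringOfIntegers v W
  have hm := W.hasMultiplicativeReductionAtPrime_iff_hasMultiplicativeReductionAt_ringOfIntegers v
  constructor
  · intro ha
    rcases hasGoodReductionAt_or_hasMultiplicativeReductionAt_or_hasAdditiveReductionAt v W with h | h | h
    · exact absurd (hg.mpr h) (ha.not_hasGoodReduction _)
    · exact absurd (hm.mpr h) (ha.not_hasMultiplicativeReduction _)
    · exact h
  · intro ha
    rcases hasGoodReduction_or_hasMultiplicativeReduction_or_hasAdditiveReduction ℤ_[primesEquiv v]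
      (W := (W.baseChange ℚ_[primesEquiv v]).minimal ℤ_[primesEquiv v]) with h | h | h
    · exact absurd (hg.mp h) (ha.not_hasGoodReductionAt)
    · exact absurd (hm.mp h) (ha.not_hasMultiplicativeReductionAt)
    · exact h

/-- Additive reduction over `ℤ_[p]` ↔ at the place of `ℤ` under `p`. [folklore] -/
theorem hasAdditiveReduction_padic_iff_hasAdditiveReductionAt_int [W.IsElliptic] (p : Nat.Primes) :
    (haveI := Fact.mk p.2; ((W.baseChange ℚ_[p]).minimal ℤ_[p]).HasAdditiveReduction ℤ_[p]) ↔
      W.HasAdditiveReductionAt ((primesEquiv (R := ℤ)).symm p) := by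
  haveI := Fact.mk p.2
  have hg := W.hasGoodReductionAtPrime_iff_hasGoodReductionAt_holds p
  have hm := W.hasMultiplicativeReductionAtPrime_iff_hasMultiplicativeReductionAt_holds p
  set v := (primesEquiv (R := ℤ)).symm p
  constructor
  · intro ha
    rcases hasGoodReductionAt_or_hasMultiplicativeReductionAt_or_hasAdditiveReductionAt v W with h | h | h
    · exact absurd (hg.mpr h) (ha.not_hasGoodReduction _)
    · exact absurd (hm.mpr h) (ha.not_hasMultiplicativeReduction _)
    · exact h
  · intro ha
    rcases hasGoodReduction_or_hasMultiplicativeReduction_or_hasAdditiveReduction ℤ_[p]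
      (W := (W.baseChange ℚ_[p]).minimal ℤ_[p]) with h | h | h
    · exact absurd (hg.mp h) (ha.not_hasGoodReductionAt)
    · exact absurd (hm.mp h) (ha.not_hasMultiplicativeReductionAt)
    · exact h

/-- Additive reduction at the place of `ℤ` under `p` ↔ at the place of `𝓞 ℚ` over `p`. [folklore] -/
theorem hasAdditiveReductionAt_int_iff_ringOfIntegers [W.IsElliptic] (p : Nat.Primes) :
    W.HasAdditiveReductionAt ((primesEquiv (R := ℤ)).symm p) ↔
      W.HasAdditiveReductionAt ((primesEquiv (R := 𝓞 ℚ)).symm p) := by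
  rw [← W.hasAdditiveReduction_padic_iff_hasAdditiveReductionAt_int p]
  have h := W.hasAdditiveReduction_padic_iff_hasAdditiveReductionAt_ringOfIntegers
    ((primesEquiv (R := 𝓞 ℚ)).symm p)
  have hv : primesEquiv ((primesEquiv (R := 𝓞 ℚ)).symm p) = p := Equiv.apply_symm_apply _ p
  revert h
  generalize primesEquiv ((primesEquiv (R := 𝓞 ℚ)).symm p) = q at hv ⊢
  subst hv
  exact id

/-! ### `aₙ(E) = 0` for `p ∣ n` at a prime of additive reduction -/

/-- At a place of additive reduction Mathlib's local Euler factor is trivial (`L_v(T) = 1`).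
[cite: SilvermanAEC2009, App. C §16] -/
theorem localEulerFactor_eq_one_of_hasAdditiveReduction {R : Type*} [CommRing R] [IsDomain R]
    [IsDiscreteValuationRing R] {K : Type*} [Field K] [Algebra R K] [IsFractionRing R K]
    (X : WeierstrassCurve K) (h : (X.minimal R).HasAdditiveReduction R) : X.localEulerFactor R = 1 := by
  have hlp : X.localPolynomial R = 1 := by
    unfold localPolynomial
    rw [if_neg (h.not_hasGoodReduction R), if_neg (fun hs ↦ h.not_hasMultiplicativeReduction R
      hs.toHasMultiplicativeReduction), if_neg (h.not_hasMultiplicativeReduction R)]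
  have hps : X.localPowerSeries R = 1 := by
    rw [localPowerSeries, hlp, Polynomial.coe_one]
    have h1 := PowerSeries.mul_invOfUnit (1 : PowerSeries ℤ) 1 (by simp)
    rwa [one_mul] at h1
  rw [localEulerFactor, hps, map_one]

/-- **`aₙ(E) = 0` whenever `p ∣ n`, for a prime `p` of additive reduction**: the Euler factor at `p`
is `1`, so no Dirichlet coefficient at a multiple of `p` survives (twist the Euler product by the
indicator of the integers prime to `p`, `eulerProduct_apply_eq_mul_of_forall`). [folklore] -/
theorem LFunction_apply_eq_zero_of_hasAdditiveReductionAt [W.IsElliptic] {p : ℕ} [Fact p.Prime]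
    {v : HeightOneSpectrum (𝓞 ℚ)} (hv : (primesEquiv v : ℕ) = p) (hadd : W.HasAdditiveReductionAt v)
    {n : ℕ} (hn : p ∣ n) : W.LFunction n = 0 := by
  -- `ε = 𝟙_{p ∤ ·}` is completely multiplicative
  set ε : ℕ → ℤ := fun n ↦ if p ∣ n then 0 else 1 with hε
  have hp1 : ¬ p ∣ 1 := (Fact.out : p.Prime).one_lt.ne' ∘ Nat.dvd_one.mp
  have hε1 : ε 1 = 1 := by simp [hε, hp1]
  have hεmul : ∀ m n, ε (m * n) = ε m * ε n := by
    intro m n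
    simp only [hε, (Fact.out : p.Prime).dvd_mul]
    by_cases hm : p ∣ m <;> by_cases hn' : p ∣ n <;> simp [hm, hn']
  have key : W.LFunction n = ε n * W.LFunction n := by
    rw [LFunction_eq_eulerProduct]
    refine ArithmeticFunction.eulerProduct_apply_eq_mul_of_forall (P := fun _ ↦ True)
      (fun _ _ _ ↦ ⟨trivial, trivial⟩) ε hε1 hεmul _ _ (fun w m _ ↦ ?_)
      (eventually_cofinite_localEulerFactor_apply _) (eventually_cofinite_localEulerFactor_apply _) trivial
    haveI := Fact.mk (primesEquiv w).2
    by_cases hwp : (primesEquiv w : ℕ) = p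
    · -- at `p`: the factor is `1`
      have hadd' : ((W.baseChange (w.adicCompletion ℚ)).minimal (w.adicCompletionIntegers ℚ)).HasAdditiveReduction
          (w.adicCompletionIntegers ℚ) := by
        have hvw : w = v := primesEquiv.injective (Subtype.ext (hwp.trans hv.symm))
        subst hvw
        exact hadd
      rw [localEulerFactor_eq_one_of_hasAdditiveReduction _ hadd', ArithmeticFunction.one_apply]
      split_ifs with h1
      · rw [h1, hε1, mul_one]
      · rw [mul_zero]
    · -- at `w ≠ p`: the factor is supported on powers of `ℓ ≠ p`, where `ε = 1`
      by_cases hm : ∃ k, Nat.card (IsLocalRing.ResidueField (w.adicCompletionIntegers ℚ)) ^ k = m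
      · obtain ⟨k, rfl⟩ := hm
        rw [natCard_residueField_adicCompletionIntegers]
        have : ¬ p ∣ (primesEquiv w : ℕ) ^ k := fun h ↦ hwp
          ((Nat.prime_dvd_prime_iff_eq Fact.out (primesEquiv w).2).mp ((Fact.out : p.Prime).dvd_of_dvd_pow h)).symm
        simp [hε, this]
      · have hq : 1 < Nat.card (IsLocalRing.ResidueField (w.adicCompletionIntegers ℚ)) := by
          rw [natCard_residueField_adicCompletionIntegers]
          exact (primesEquiv w).2.one_lt
        rw [localEulerFactor_apply_eq_zero _ _ hq hm, mul_zero]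
  rw [key]
  simp [hε, hn]

/-! ### The `q`-expansions of the newforms of `E` and `E^{(p*)}` -/

/-- **`aₙ(f) = (n/p) aₙ(f')`** for the newforms `f` of `E` and `f'` of `E' = E^{(p*)}`, `E` additive at
`p`: for `p ∤ n` this is `aₙ(E') = (n/p) aₙ(E)` and `(n/p)² = 1`; for `p ∣ n` both sides vanish.
[folklore] -/
theorem cuspCoeff_eq_legendreSym_mul_cuspCoeff [W.IsElliptic] {p : ℕ} [Fact p.Prime] (hp2 : p ≠ 2)
    {v : HeightOneSpectrum (𝓞 ℚ)} (hv : (primesEquiv v : ℕ) = p) (hadd : W.HasAdditiveReductionAt v)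
    {N N' : ℕ} [NeZero N] [NeZero N'] {f : CuspForm (Gamma0 N) 2} {f' : CuspForm (Gamma0 N') 2}
    (hf : IsNewformOf W f)
    (hf' : IsNewformOf (W.quadraticTwist (((-1 : ℤ) ^ (p / 2) * p : ℤ) : ℚ)) f') (n : ℕ) :
    cuspCoeff f n = (legendreSym p n : ℂ) * cuspCoeff f' n := by
  rw [hf.2 n, hf'.2 n]
  by_cases hpn : p ∣ n
  · have h0 : legendreSym p n = 0 :=
      (legendreSym.eq_zero_iff p n).mpr (by exact_mod_cast (ZMod.natCast_eq_zero_iff n p).mpr hpn)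
    rw [W.LFunction_apply_eq_zero_of_hasAdditiveReductionAt hv hadd hpn, h0]
    push_cast
    ring
  · have hsq : (legendreSym p n : ℂ) ^ 2 = 1 := by
      have h := legendreSym.sq_one p (a := n) (by
        rw [Ne, ZMod.intCast_zmod_eq_zero_iff_dvd]
        exact_mod_cast hpn)
      exact_mod_cast h
    rw [W.LFunction_quadraticTwist_pStar_apply hp2 hpn]
    push_cast
    linear_combination (-(W.LFunction n : ℂ)) * hsq

/-! ### Integers in `O_v` for a place `v` of `ℤ` -/

section IntPlaces

variable (v : HeightOneSpectrum ℤ)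

/-- An integer not divisible by the prime under `v` has `v`-adic valuation `1` (`v = (p_v)`, Mathlib
`Rat.HeightOneSpectrum.span_natGenerator` with `intEquiv ℤ = id`). [folklore] -/
theorem valuation_int_intCast_eq_one {n : ℤ} (hn : ¬ ((natGenerator v : ℕ) : ℤ) ∣ n) :
    v.valuation ℚ (n : ℚ) = 1 := by
  have he : Rat.IsIntegralClosure.intEquiv ℤ = RingEquiv.refl ℤ := RingEquiv.ext fun x ↦ by simp
  have hI : v.asIdeal = Ideal.span {((natGenerator v : ℕ) : ℤ)} := by
    rw [span_natGenerator, he]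
    exact (Ideal.map_id _).symm
  rw [show (n : ℚ) = algebraMap ℤ ℚ n from (eq_intCast _ n).symm, valuation_eq_one_iff_notMem, hI,
    Ideal.mem_span_singleton]
  exact hn

/-- An integer divisible by the prime under `v` has `v`-adic valuation `< 1`. [folklore] -/
theorem valuation_int_intCast_lt_one {n : ℤ} (hn : ((natGenerator v : ℕ) : ℤ) ∣ n) :
    v.valuation ℚ (n : ℚ) < 1 := by
  have he : Rat.IsIntegralClosure.intEquiv ℤ = RingEquiv.refl ℤ := RingEquiv.ext fun x ↦ by simp
  have hI : v.asIdeal = Ideal.span {((natGenerator v : ℕ) : ℤ)} := by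
    rw [span_natGenerator, he]
    exact (Ideal.map_id _).symm
  rw [show (n : ℚ) = algebraMap ℤ ℚ n from (eq_intCast _ n).symm, valuation_lt_one_iff_mem, hI,
    Ideal.mem_span_singleton]
  exact hn

/-- The image in `K_v` of an integer through `O_v` is its image through `ℚ`. [folklore] -/
theorem algebraMap_int_adicCompletionIntegers_intCast (n : ℤ) :
    algebraMap (v.adicCompletionIntegers ℚ) (v.adicCompletion ℚ) (n : v.adicCompletionIntegers ℚ) =
      algebraMap ℚ (v.adicCompletion ℚ) (n : ℚ) := by
  rw [map_intCast, map_intCast]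

/-- An integer prime to the prime under `v` is a unit of `O_v`. [folklore] -/
theorem isUnit_int_adicCompletionIntegers_intCast {n : ℤ} (hn : ¬ ((natGenerator v : ℕ) : ℤ) ∣ n) :
    IsUnit (n : v.adicCompletionIntegers ℚ) := by
  rw [adicCompletionIntegers.isUnit_iff_valued_eq_one,
    show ((n : v.adicCompletionIntegers ℚ) : v.adicCompletion ℚ) = algebraMap ℚ (v.adicCompletion ℚ) (n : ℚ)
      from algebraMap_int_adicCompletionIntegers_intCast v n, valued_algebraMap,
    valuation_int_intCast_eq_one v hn]

/-- An integer divisible by the prime under `v` reduces to `0` in the residue field of `O_v`.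
[folklore] -/
theorem residue_int_adicCompletionIntegers_intCast_eq_zero {n : ℤ} (hn : ((natGenerator v : ℕ) : ℤ) ∣ n) :
    IsLocalRing.residue _ (n : v.adicCompletionIntegers ℚ) = 0 := by
  rw [IsLocalRing.residue_eq_zero_iff, IsLocalRing.mem_maximalIdeal, mem_nonunits_iff,
    adicCompletionIntegers.isUnit_iff_valued_eq_one,
    show ((n : v.adicCompletionIntegers ℚ) : v.adicCompletion ℚ) = algebraMap ℚ (v.adicCompletion ℚ) (n : ℚ)
      from algebraMap_int_adicCompletionIntegers_intCast v n, valued_algebraMap]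
  exact (valuation_int_intCast_lt_one v hn).ne

end IntPlaces

/-! ### Reduction types of `E^{(p*)}` and `E` agree away from `p` -/

/-- **Away from `p`, `E^{(p*)}` and `E` have the same reduction type** (at every place `v ∤ p` of `ℤ`):
`p*` is a `v`-adic unit (`p* = 1 + 4c` at `2`), so a minimal model of `E` twists to a minimal model of
`E^{(p*)}` with the same `v(Δ)`, `v(c₄)` (`isMinimal_quadraticTwist`, `isMinimal_baseChange_twistLiftTwo`).
[cite: SilvermanAEC2009, VII.5 Prop. 5.1 and X.2 Prop. 2.4] -/
theorem hasReductionAt_quadraticTwist_pStar_iff [W.IsElliptic] {p : ℕ} [Fact p.Prime] (hp2 : p ≠ 2)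
    (v : HeightOneSpectrum ℤ) (hv : natGenerator v ≠ p) :
    ((W.quadraticTwist (((-1 : ℤ) ^ (p / 2) * p : ℤ) : ℚ)).HasGoodReductionAt v ↔ W.HasGoodReductionAt v) ∧
      ((W.quadraticTwist (((-1 : ℤ) ^ (p / 2) * p : ℤ) : ℚ)).HasMultiplicativeReductionAt v ↔
        W.HasMultiplicativeReductionAt v) ∧
      ((W.quadraticTwist (((-1 : ℤ) ^ (p / 2) * p : ℤ) : ℚ)).HasAdditiveReductionAt v ↔
        W.HasAdditiveReductionAt v) := by
  haveI : NeZero (2 : v.adicCompletion ℚ) := ⟨by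
    rw [← map_ofNat (algebraMap ℚ (v.adicCompletion ℚ)) 2]; exact (map_ne_zero _).mpr two_ne_zero⟩
  set d : ℤ := (-1 : ℤ) ^ (p / 2) * p with hd
  set O := v.adicCompletionIntegers ℚ
  set K := v.adicCompletion ℚ
  have hd0 : (d : ℚ) ≠ 0 := by
    rw [hd]; push_cast
    exact mul_ne_zero (pow_ne_zero _ (by norm_num)) (by exact_mod_cast (Fact.out : p.Prime).ne_zero)
  haveI : (W.quadraticTwist (d : ℚ)).IsElliptic := W.isElliptic_quadraticTwist hd0
  haveI : (W.baseChange K).IsElliptic := by change (W.map _).IsElliptic; infer_instance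
  set Xm := W.localMinimalModel v with hXm
  haveI : Xm.IsElliptic := W.isElliptic_localMinimalModel v
  obtain ⟨C, hX⟩ : ∃ C : VariableChange K, W.baseChange K = C • Xm :=
    ⟨_, (inv_smul_smul ((W.baseChange K).exists_isMinimal O).choose (W.baseChange K)).symm⟩
  have hq : (natGenerator v).Prime := prime_natGenerator v
  -- a minimal model `Y` of the twist with the same reduction type as `Xm`
  obtain ⟨Y, D, hYmin, hW'Y, hg, hm, ha⟩ : ∃ (Y : WeierstrassCurve K) (D : VariableChange K),
      IsMinimal O Y ∧ (W.quadraticTwist (d : ℚ)).baseChange K = D • Y ∧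
      (Y.HasGoodReduction O ↔ Xm.HasGoodReduction O) ∧
      (Y.HasMultiplicativeReduction O ↔ Xm.HasMultiplicativeReduction O) ∧
      (Y.HasAdditiveReduction O ↔ Xm.HasAdditiveReduction O) := by
    have htwK : (W.quadraticTwist (d : ℚ)).baseChange K = (W.baseChange K).quadraticTwist (d : K) := by
      rw [baseChange, map_quadraticTwist, map_intCast]; rfl
    by_cases hv2 : natGenerator v = 2
    · -- at `2`: `d = 1 + 4c`
      obtain ⟨c, hc⟩ := four_dvd_pStar_sub_one (p := p) hp2
      rw [← hd] at hc
      have hdc : d = 1 + 4 * c := by linear_combination hc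
      have hk : IsLocalRing.residue _ (2 : O) = 0 := by
        have := residue_int_adicCompletionIntegers_intCast_eq_zero v (n := 2) (by rw [hv2]; norm_num)
        simpa using this
      haveI hYmin : IsMinimal O ((⟨(Xm.integralModel O).a₁,
          c * (Xm.integralModel O).a₁ ^ 2 + (1 + 4 * c) * (Xm.integralModel O).a₂,
          (1 + 4 * c) * (Xm.integralModel O).a₃,
          2 * (1 + 4 * c) * c * (Xm.integralModel O).a₁ * (Xm.integralModel O).a₃ +
            (1 + 4 * c) ^ 2 * (Xm.integralModel O).a₄,
          (1 + 4 * c) ^ 2 * c * (Xm.integralModel O).a₃ ^ 2 +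
            (1 + 4 * c) ^ 3 * (Xm.integralModel O).a₆⟩ : WeierstrassCurve O).baseChange K) :=
        isMinimal_baseChange_twistLiftTwo O hk Xm (c : O)
      have hdK : (d : K) = algebraMap O K (1 + 4 * (c : O)) := by
        rw [show (1 + 4 * (c : O)) = ((1 + 4 * c : ℤ) : O) by push_cast; ring, ← hdc,
          algebraMap_int_adicCompletionIntegers_intCast, map_intCast]
      refine ⟨_, ⟨C.u, (d : K) * C.r, 0, 0⟩ * ⟨1, 0, -Xm.a₁ / 2, -(algebraMap O K (1 + 4 * (c : O))) * Xm.a₃ / 2⟩,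
        hYmin, ?_, hasGoodReduction_twistLiftTwo_iff O hk, hasMultiplicativeReduction_twistLiftTwo_iff O hk,
        hasAdditiveReduction_twistLiftTwo_iff O hk⟩
      rw [htwK, hX, quadraticTwist_smul, hdK, ← smul_baseChange_twistLiftTwo O Xm (c : O), smul_smul]
    · -- odd `v`: `d` is a `v`-unit
      have hℓd : ¬ ((natGenerator v : ℕ) : ℤ) ∣ d := by
        rw [hd]; intro h
        have hu : IsUnit ((-1 : ℤ) ^ (p / 2)) := (isUnit_neg_one (α := ℤ)).pow _
        have h' := (hu.dvd_mul_left).mp h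
        exact hv ((Nat.prime_dvd_prime_iff_eq hq Fact.out).mp (Int.natCast_dvd_natCast.mp h'))
      have hℓ2 : ¬ ((natGenerator v : ℕ) : ℤ) ∣ 2 := fun h ↦
        hv2 ((Nat.prime_dvd_prime_iff_eq hq Nat.prime_two).mp (Int.natCast_dvd_natCast.mp h))
      have hu := isUnit_int_adicCompletionIntegers_intCast v hℓd
      have h2 : IsUnit (2 : O) := by simpa using isUnit_int_adicCompletionIntegers_intCast v hℓ2
      haveI hYmin : IsMinimal O (Xm.quadraticTwist (algebraMap O K hu.unit)) := isMinimal_quadraticTwist O Xm h2 _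
      have hdK : (d : K) = algebraMap O K hu.unit := by
        rw [IsUnit.unit_spec, algebraMap_int_adicCompletionIntegers_intCast, map_intCast]
      refine ⟨_, ⟨C.u, (d : K) * C.r, 0, 0⟩, hYmin, ?_, hasGoodReduction_quadraticTwist_iff O,
        hasMultiplicativeReduction_quadraticTwist_iff O, hasAdditiveReduction_quadraticTwist_iff O⟩
      rw [htwK, hX, quadraticTwist_smul, hdK]
  -- compare with the chosen local minimal model of the twist
  haveI := hYmin
  haveI : Y.IsElliptic := by
    have h := congrArg WeierstrassCurve.Δ hW'Y
    rw [variableChange_Δ] at h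
    refine ⟨isUnit_iff_ne_zero.mpr fun hY ↦ ?_⟩
    have : ((W.quadraticTwist (d : ℚ)).baseChange K).Δ = 0 := by rw [h, hY, mul_zero]
    exact ((W.quadraticTwist (d : ℚ)).baseChange K).isUnit_Δ.ne_zero
      (by change ((W.quadraticTwist (d : ℚ)).map _).Δ = 0 at this; exact this)
  have hrel : (W.quadraticTwist (d : ℚ)).localMinimalModel v =
      ((((W.quadraticTwist (d : ℚ)).baseChange K).exists_isMinimal O).choose * D) • Y := by
    rw [mul_smul, ← hW'Y]; rfl
  have hΔY : Y.Δ ≠ 0 := Y.isUnit_Δ.ne_zero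
  refine ⟨?_, ?_, ?_⟩
  · change ((W.quadraticTwist (d : ℚ)).localMinimalModel v).HasGoodReduction O ↔ Xm.HasGoodReduction O
    rw [hasGoodReduction_iff_of_isMinimal_of_eq_smul O hrel, hg]
  · change ((W.quadraticTwist (d : ℚ)).localMinimalModel v).HasMultiplicativeReduction O ↔
      Xm.HasMultiplicativeReduction O
    rw [hasMultiplicativeReduction_iff_of_isMinimal_of_eq_smul O hrel hΔY, hm]
  · change ((W.quadraticTwist (d : ℚ)).localMinimalModel v).HasAdditiveReduction O ↔ Xm.HasAdditiveReduction O
    rw [hasAdditiveReduction_iff_of_isMinimal_of_eq_smul O hrel hΔY, ha]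

/-! ### Two minimality criteria over a DVR (Silverman, AEC VII.1, Remark 1.1) -/

section MinimalityCriteria

variable {R : Type*} [CommRing R] [IsDomain R] [IsDiscreteValuationRing R]
  {K : Type*} [Field K] [Algebra R K] [IsFractionRing R K]

/-- **An integral equation with `v(Δ) < 12` is minimal** (Silverman, *AEC* VII.1, Remark 1.1): for an
integral `C • X`, `v(Δ(C • X)) = v(u⁻¹)¹² v(Δ) ≤ 1` and `v(Δ) > exp(−12)` force `v(u⁻¹) ≤ 1`.
(DVR version of the tree's `isMinimalAt_of_lt_valuation_Δ_holds`.) [cite: SilvermanAEC2009, VII.1 Remark 1.1] -/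
theorem isMinimal_of_exp_lt_valuation_Δ (X : WeierstrassCurve K) [X.IsIntegral R]
    (h : WithZero.exp (-12 : ℤ) < (IsDiscreteValuationRing.maximalIdeal R).valuation K X.Δ) :
    X.IsMinimal R := by
  have hV1 : ∀ x : K, (IsDiscreteValuationRing.maximalIdeal R).valuation K x ≤ 1 ↔ x ∈ (algebraMap R K).range :=
    fun x ↦ ⟨fun h ↦ IsDiscreteValuationRing.exists_lift_of_le_one h,
      fun ⟨r, hr⟩ ↦ hr ▸ IsDedekindDomain.HeightOneSpectrum.valuation_le_one _ r⟩
  rw [isMinimal_iff_of_le_one_iff hV1 X]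
  refine ⟨inferInstance, fun C hC ↦ ?_⟩
  set V := (IsDiscreteValuationRing.maximalIdeal R).valuation K with hV
  haveI := hC
  have hint : V (C • X).Δ ≤ 1 := (hV1 _).mpr ⟨_, integralModel_Δ_eq R (C • X)⟩
  rw [variableChange_Δ, Valuation.map_mul, Valuation.map_pow] at hint ⊢
  set a := V (↑C.u⁻¹ : K) with ha
  set d := V X.Δ with hd
  have ha0 : a ≠ 0 := by simp [ha]
  have hd0 : d ≠ 0 := (WithZero.exp_pos.trans h).ne'
  have had0 : a ^ 12 * d ≠ 0 := mul_ne_zero (pow_ne_zero _ ha0) hd0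
  have h1 : -12 < WithZero.log d := WithZero.lt_log_of_exp_lt h
  have h2 : 12 • WithZero.log a + WithZero.log d ≤ 0 := by
    rw [← WithZero.log_pow, ← WithZero.log_mul (pow_ne_zero _ ha0) hd0, ← WithZero.log_one]
    exact (WithZero.log_le_log had0 one_ne_zero).mpr hint
  refine (WithZero.log_le_log had0 hd0).mp ?_
  rw [WithZero.log_mul (pow_ne_zero _ ha0) hd0, WithZero.log_pow]
  simp only [nsmul_eq_mul, Nat.cast_ofNat] at h2 ⊢
  omega

/-- **An integral equation with `v(c₄) < 4` is minimal** (Silverman, *AEC* VII.1, Remark 1.1): for an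
integral `C • X`, `v(c₄(C • X)) = v(u⁻¹)⁴ v(c₄) ≤ 1` and `v(c₄) > exp(−4)` force `v(u⁻¹) ≤ 1`, so
`v(Δ(C • X)) = v(u⁻¹)¹² v(Δ) ≤ v(Δ)`. [cite: SilvermanAEC2009, VII.1 Remark 1.1] -/
theorem isMinimal_of_exp_lt_valuation_c₄ (X : WeierstrassCurve K) [X.IsIntegral R]
    (h : WithZero.exp (-4 : ℤ) < (IsDiscreteValuationRing.maximalIdeal R).valuation K X.c₄) :
    X.IsMinimal R := by
  have hV1 : ∀ x : K, (IsDiscreteValuationRing.maximalIdeal R).valuation K x ≤ 1 ↔ x ∈ (algebraMap R K).range :=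
    fun x ↦ ⟨fun h ↦ IsDiscreteValuationRing.exists_lift_of_le_one h,
      fun ⟨r, hr⟩ ↦ hr ▸ IsDedekindDomain.HeightOneSpectrum.valuation_le_one _ r⟩
  rw [isMinimal_iff_of_le_one_iff hV1 X]
  refine ⟨inferInstance, fun C hC ↦ ?_⟩
  set V := (IsDiscreteValuationRing.maximalIdeal R).valuation K with hV
  haveI := hC
  have hc : V (C • X).c₄ ≤ 1 := (hV1 _).mpr ⟨_, integralModel_c₄_eq R (C • X)⟩
  rw [variableChange_c₄, Valuation.map_mul, Valuation.map_pow] at hc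
  set a := V (↑C.u⁻¹ : K) with ha
  set c := V X.c₄ with hc'
  have ha0 : a ≠ 0 := by simp [ha]
  have hc0 : c ≠ 0 := (WithZero.exp_pos.trans h).ne'
  have hac0 : a ^ 4 * c ≠ 0 := mul_ne_zero (pow_ne_zero _ ha0) hc0
  have h1 : -4 < WithZero.log c := WithZero.lt_log_of_exp_lt h
  have h2 : 4 • WithZero.log a + WithZero.log c ≤ 0 := by
    rw [← WithZero.log_pow, ← WithZero.log_mul (pow_ne_zero _ ha0) hc0, ← WithZero.log_one]
    exact (WithZero.log_le_log hac0 one_ne_zero).mpr hc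
  have hu : WithZero.log a ≤ 0 := by
    simp only [nsmul_eq_mul, Nat.cast_ofNat] at h2
    omega
  have hu' : a ≤ 1 := by
    rw [← WithZero.log_one] at hu
    exact (WithZero.log_le_log ha0 one_ne_zero).mp hu
  rw [variableChange_Δ, Valuation.map_mul, Valuation.map_pow]
  exact mul_le_of_le_one_left zero_le (pow_le_one₀ zero_le hu')

open IsDiscreteValuationRing (addVal) in
/-- `addVal r = 0 ↔ v_𝔪(r) = 1` for `r ∈ R` (both say `r ∈ Rˣ`). [folklore] -/
theorem addVal_eq_zero_iff_valuation_eq_one (r : R) :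
    addVal R r = 0 ↔ (IsDiscreteValuationRing.maximalIdeal R).valuation K (algebraMap R K r) = 1 := by
  rw [IsDiscreteValuationRing.addVal_eq_zero_iff,
    IsDedekindDomain.HeightOneSpectrum.valuation_eq_one_iff_notMem]
  exact IsLocalRing.notMem_maximalIdeal.symm

open IsDiscreteValuationRing (addVal) in
/-- `addVal r ≠ 0 ↔ v_𝔪(r) < 1` for `r ∈ R` (both say `r ∈ 𝔪`). [folklore] -/
theorem addVal_ne_zero_iff_valuation_lt_one (r : R) :
    addVal R r ≠ 0 ↔ (IsDiscreteValuationRing.maximalIdeal R).valuation K (algebraMap R K r) < 1 := by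
  rw [Ne, IsDiscreteValuationRing.addVal_eq_zero_iff,
    IsDedekindDomain.HeightOneSpectrum.valuation_lt_one_iff_mem]
  change ¬IsUnit r ↔ r ∈ IsLocalRing.maximalIdeal R
  rw [IsLocalRing.mem_maximalIdeal, mem_nonunits_iff]

end MinimalityCriteria

/-! ### The local root number at an additive prime `p ≥ 5` of quadratic-twist type -/

section Padic

variable {p : ℕ} [Fact p.Prime]

open IsDiscreteValuationRing (addVal)

/-- `ord_p(p*) = 1` in `ℤ_p`. [folklore] -/
theorem addVal_padicInt_pStar : addVal ℤ_[p] ((((-1 : ℤ) ^ (p / 2) * p : ℤ)) : ℤ_[p]) = 1 := by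
  push_cast
  rw [IsDiscreteValuationRing.addVal_mul,
    IsDiscreteValuationRing.addVal_eq_zero_iff.mpr ((isUnit_neg_one (α := ℤ_[p])).pow _), zero_add,
    IsDiscreteValuationRing.addVal_uniformizer (PadicInt.irreducible_p (p := p))]

/-- `|p*|_𝔪 = exp(−1)` for the `𝔪`-adic valuation of `ℚ_p`. [folklore] -/
theorem valuation_padic_pStar :
    (IsDiscreteValuationRing.maximalIdeal ℤ_[p]).valuation ℚ_[p] ((((-1 : ℤ) ^ (p / 2) * p : ℤ)) : ℚ_[p]) =
      WithZero.exp (-1 : ℤ) := by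
  rw [show ((((-1 : ℤ) ^ (p / 2) * p : ℤ)) : ℚ_[p]) = algebraMap ℤ_[p] ℚ_[p] ((-1) ^ (p / 2) * p) by
      push_cast; simp,
    IsDedekindDomain.HeightOneSpectrum.valuation_of_algebraMap, Valuation.map_mul, Valuation.map_pow,
    Valuation.map_neg, Valuation.map_one, one_pow, one_mul]
  exact IsDedekindDomain.HeightOneSpectrum.intValuation_singleton _
    (Nat.cast_ne_zero.mpr (Fact.out : p.Prime).ne_zero) PadicInt.maximalIdeal_eq_span_p

/-- `2 ∈ ℤ_pˣ` for odd `p`. [folklore] -/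
theorem isUnit_two_padicInt (hp2 : p ≠ 2) : IsUnit (2 : ℤ_[p]) := by
  rw [PadicInt.isUnit_iff, show (2 : ℤ_[p]) = ((2 : ℕ) : ℤ_[p]) by norm_cast,
    PadicInt.norm_natCast_eq_one_iff]
  exact (Nat.coprime_primes Fact.out Nat.prime_two).mpr hp2

/-- **`W_p(E) = (−1/p)` at an additive prime `p ≥ 5` of quadratic-twist type** (Rohrlich 1993,
Prop. 2(iii) and the case `e = 2` of (iv); Kellock–Dokchitser 2023, Thm. 2.3). If `E / ℚ_p` has
additive reduction and `E' = E^{(p*)}` does not, let `X'` be a minimal model of `E'` and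
`Y = X'^{(p*)}`, an integral model of `E` with `v(c₄(Y)) = v(c₄(X')) + 2`, `v(Δ(Y)) = v(Δ(X')) + 6`.
If `X'` is multiplicative then `v(c₄(Y)) = 2 < 4`, so `Y` is minimal and `3 v(c₄) = 6 < 6 + v(Δ(X'))`
(potentially multiplicative: `w_p = (−1/p)`); if `X'` is good then `v(Δ(Y)) = 6 < 12`, so `Y` is
minimal, `v(j) ≥ 0` and `e = 12 / gcd(6, 12) = 2` (`w_p = (−1/p)`). The tree's case list
`localRootNumber_padic_of_hasAdditiveReduction` reads these off any minimal model
(`addVal_Δ_integralModel_eq_of_isMinimal_of_eq_smul`, `addVal_c₄_integralModel_eq_of_isMinimal_of_eq_smul`).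
[cite: Rohrlich1993Compositio, Prop. 2(iii),(iv)] [cite: KellockDokchitser2023, Thm. 2.3] -/
theorem localRootNumber_padic_eq_χ₄_of_twist (W : WeierstrassCurve ℚ) [W.IsElliptic] (hp5 : 5 ≤ p)
    (hadd : ((W.baseChange ℚ_[p]).minimal ℤ_[p]).HasAdditiveReduction ℤ_[p])
    (hsemi : ¬ (((W.quadraticTwist (((-1 : ℤ) ^ (p / 2) * p : ℤ) : ℚ)).baseChange ℚ_[p]).minimal
      ℤ_[p]).HasAdditiveReduction ℤ_[p]) :
    (W.baseChange ℚ_[p]).localRootNumber ℤ_[p] = ZMod.χ₄ p := by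
  have hvald := addVal_padicInt_pStar (p := p)
  have hVd := valuation_padic_pStar (p := p)
  set d : ℤ := (-1 : ℤ) ^ (p / 2) * p with hd
  set V := (IsDiscreteValuationRing.maximalIdeal ℤ_[p]).valuation ℚ_[p] with hV
  have hp2 : p ≠ 2 := by omega
  have h2 : IsUnit (2 : ℤ_[p]) := isUnit_two_padicInt hp2
  have hdZ0 : d ≠ 0 :=
    mul_ne_zero (pow_ne_zero _ (by norm_num)) (by exact_mod_cast (Fact.out : p.Prime).ne_zero)
  have hd0 : (d : ℚ) ≠ 0 := by exact_mod_cast hdZ0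
  have hdK0 : (d : ℚ_[p]) ≠ 0 := by exact_mod_cast hdZ0
  have hdK : (d : ℚ_[p]) = algebraMap ℤ_[p] ℚ_[p] (d : ℤ_[p]) := by simp
  haveI : (W.quadraticTwist (d : ℚ)).IsElliptic := W.isElliptic_quadraticTwist hd0
  set Wp := W.baseChange ℚ_[p] with hWp
  set W'p := (W.quadraticTwist (d : ℚ)).baseChange ℚ_[p] with hW'p
  haveI : Wp.IsElliptic := by rw [hWp]; change (W.map _).IsElliptic; infer_instance
  haveI : W'p.IsElliptic := by rw [hW'p]; change ((W.quadraticTwist (d : ℚ)).map _).IsElliptic; infer_instance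
  have htwK : W'p = Wp.quadraticTwist (d : ℚ_[p]) := by
    rw [hW'p, hWp, baseChange, baseChange, map_quadraticTwist, map_intCast]
  -- the minimal model `X'` of `E'_p` and the integral model `Y = X'^{(d)}` of `E_p`
  set X' := W'p.minimal ℤ_[p] with hX'
  haveI : X'.IsElliptic := by rw [hX']; unfold minimal; infer_instance
  obtain ⟨C', hC'⟩ : ∃ C' : VariableChange ℚ_[p], X' = C' • W'p := ⟨_, rfl⟩
  set I' := X'.integralModel ℤ_[p] with hI'
  have hI'Δ : I'.Δ ≠ 0 := fun h0 ↦ X'.isUnit_Δ.ne_zero (by rw [← integralModel_Δ_eq ℤ_[p] X', ← hI', h0, map_zero])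
  set Y := X'.quadraticTwist (algebraMap ℤ_[p] ℚ_[p] (d : ℤ_[p])) with hY
  haveI hYint : Y.IsIntegral ℤ_[p] := isIntegral_quadraticTwist ℤ_[p] X' h2 (d : ℤ_[p])
  haveI : Y.IsElliptic := X'.isElliptic_quadraticTwist (by rw [← hdK]; exact hdK0)
  have hc₄ : (Y.integralModel ℤ_[p]).c₄ = (d : ℤ_[p]) ^ 2 * I'.c₄ := by
    apply IsFractionRing.injective ℤ_[p] ℚ_[p]
    rw [integralModel_c₄_eq, map_mul, map_pow, hI', integralModel_c₄_eq, hY, quadraticTwist_c₄]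
  have hΔ : (Y.integralModel ℤ_[p]).Δ = (d : ℤ_[p]) ^ 6 * I'.Δ := by
    apply IsFractionRing.injective ℤ_[p] ℚ_[p]
    rw [integralModel_Δ_eq, map_mul, map_pow, hI', integralModel_Δ_eq, hY, quadraticTwist_Δ]
  have hvc₄ : addVal ℤ_[p] (Y.integralModel ℤ_[p]).c₄ = 2 + addVal ℤ_[p] I'.c₄ := by
    rw [hc₄, IsDiscreteValuationRing.addVal_mul, IsDiscreteValuationRing.addVal_pow, hvald, nsmul_one,
      Nat.cast_ofNat]
  have hvΔ : addVal ℤ_[p] (Y.integralModel ℤ_[p]).Δ = 6 + addVal ℤ_[p] I'.Δ := by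
    rw [hΔ, IsDiscreteValuationRing.addVal_mul, IsDiscreteValuationRing.addVal_pow, hvald, nsmul_one,
      Nat.cast_ofNat]
  rw [hdK] at hVd
  -- `Y` is minimal, with `3 v(c₄(Y)) < v(Δ(Y))` (multiplicative `X'`) or `v(Δ(Y)) = 6` (good `X'`)
  obtain ⟨hYmin, hnum⟩ : Y.IsMinimal ℤ_[p] ∧
      (3 * addVal ℤ_[p] (Y.integralModel ℤ_[p]).c₄ < addVal ℤ_[p] (Y.integralModel ℤ_[p]).Δ ∨
        (¬ 3 * addVal ℤ_[p] (Y.integralModel ℤ_[p]).c₄ < addVal ℤ_[p] (Y.integralModel ℤ_[p]).Δ ∧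
          addVal ℤ_[p] (Y.integralModel ℤ_[p]).Δ = 6)) := by
    rcases hasGoodReduction_or_hasMultiplicativeReduction_or_hasAdditiveReduction ℤ_[p] (W := X') with
      hg | hm | ha
    · -- good `X'`: `v(Δ') = 0`
      have hΔ1 : V X'.Δ = 1 := hg.goodReduction
      have hΔ0 : addVal ℤ_[p] I'.Δ = 0 := by
        rw [addVal_eq_zero_iff_valuation_eq_one (K := ℚ_[p]), hI', integralModel_Δ_eq]; exact hΔ1
      refine ⟨isMinimal_of_exp_lt_valuation_Δ Y ?_, Or.inr ⟨?_, by rw [hvΔ, hΔ0, add_zero]⟩⟩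
      · change WithZero.exp (-12 : ℤ) < V Y.Δ
        rw [hY, quadraticTwist_Δ, Valuation.map_mul, Valuation.map_pow, hVd, hΔ1, mul_one,
          ← WithZero.exp_nsmul]
        exact WithZero.exp_lt_exp.mpr (by norm_num)
      · rw [hvc₄, hvΔ, hΔ0, add_zero, not_lt]
        calc (6 : ℕ∞) = 3 * 2 := by norm_num
          _ ≤ 3 * (2 + addVal ℤ_[p] I'.c₄) := by gcongr; exact le_self_add
    · -- multiplicative `X'`: `v(c₄') = 0`, `v(Δ') ≥ 1`
      have hc1 : V X'.c₄ = 1 := hm.multiplicativeReduction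
      have hΔlt : V X'.Δ < 1 := hm.badReduction
      have hc0 : addVal ℤ_[p] I'.c₄ = 0 := by
        rw [addVal_eq_zero_iff_valuation_eq_one (K := ℚ_[p]), hI', integralModel_c₄_eq]; exact hc1
      have hΔne : addVal ℤ_[p] I'.Δ ≠ 0 := by
        rw [addVal_ne_zero_iff_valuation_lt_one (K := ℚ_[p]), hI', integralModel_Δ_eq]; exact hΔlt
      refine ⟨isMinimal_of_exp_lt_valuation_c₄ Y ?_, Or.inl ?_⟩
      · change WithZero.exp (-4 : ℤ) < V Y.c₄
        rw [hY, quadraticTwist_c₄, Valuation.map_mul, Valuation.map_pow, hVd, hc1, mul_one,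
          ← WithZero.exp_nsmul]
        exact WithZero.exp_lt_exp.mpr (by norm_num)
      · rw [hvc₄, hvΔ, hc0, add_zero]
        obtain ⟨m, hm'⟩ := ENat.ne_top_iff_exists.mp (mt IsDiscreteValuationRing.addVal_eq_top_iff.mp hI'Δ)
        rw [← hm'] at hΔne ⊢
        have hm0 : m ≠ 0 := by exact_mod_cast hΔne
        have h : ((3 * 2 : ℕ) : ℕ∞) < ((6 + m : ℕ) : ℕ∞) := by exact_mod_cast (by omega : 3 * 2 < 6 + m)
        exact_mod_cast h
    · exact absurd ha hsemi
  haveI := hYmin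
  -- `E_p`'s chosen minimal model is `K`-isomorphic to `Y`
  obtain ⟨D, hD⟩ := exists_quadraticTwist_quadraticTwist_eq_smul Wp hdK0
  obtain ⟨C, hC⟩ : ∃ C : VariableChange ℚ_[p], Wp.minimal ℤ_[p] = C • Wp := ⟨_, rfl⟩
  have hYW : Y = ((⟨C'.u, (d : ℚ_[p]) * C'.r, 0, 0⟩ : VariableChange ℚ_[p]) * D) • Wp := by
    rw [mul_smul, ← hD, ← htwK, hY, ← hdK, hC', quadraticTwist_smul]
  have hE : Wp.minimal ℤ_[p] =
      (C * (((⟨C'.u, (d : ℚ_[p]) * C'.r, 0, 0⟩ : VariableChange ℚ_[p]) * D))⁻¹) • Y := by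
    rw [mul_smul, hYW, inv_smul_smul, ← hC]
  rw [Literature.NumberTheory.EllipticCurves.localRootNumber_padic_of_hasAdditiveReduction p Wp hp5 hadd,
    addVal_Δ_integralModel_eq_of_isMinimal_of_eq_smul ℤ_[p] hE,
    addVal_c₄_integralModel_eq_of_isMinimal_of_eq_smul ℤ_[p] hE Y.isUnit_Δ.ne_zero]
  rcases hnum with hlt | ⟨hnlt, h6⟩
  · rw [if_pos hlt]
  · rw [if_neg hnlt, h6, if_pos (Or.inl (by simp))]

end Padic

/-! ### The conductors of `E` and `E^{(p*)}` -/

/-- **`N_E = M p²` with `p ∤ M` and `N_{E'} ∣ M p`** for `E' = E^{(p*)}`, `p ≥ 5` an additive prime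
of `E` at which `E'` is semistable, `E` with no additive reduction at `2, 3`: `f_p(E) = 2`
(`two_le_conductorExponent_iff_holds`, `conductorExponent_le_two_of_five_le_natGenerator_holds`),
`f_p(E') ≤ 1`, and at `q ≠ p` the reduction types of `E'` and `E` agree
(`hasReductionAt_quadraticTwist_pStar_iff`), so `f_q(E') = f_q(E)` if `E` is good or multiplicative
at `q` and `f_q(E') ≤ 2 = f_q(E)` if `E` is additive at `q` (then `q ≥ 5`).
[cite: SilvermanATAEC1994, Thm. IV.10.2] -/
theorem conductorNorm_eq_mul_sq_of_twist [W.IsElliptic] (p : Nat.Primes) (hp5 : 5 ≤ (p : ℕ))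
    (hadd : W.HasAdditiveReductionAt ((primesEquiv (R := ℤ)).symm p))
    (hsemi : ¬ (W.quadraticTwist (((-1 : ℤ) ^ ((p : ℕ) / 2) * p : ℤ) : ℚ)).HasAdditiveReductionAt
      ((primesEquiv (R := ℤ)).symm p))
    (h23 : ∀ v : HeightOneSpectrum ℤ, W.HasAdditiveReductionAt v → 3 < ringChar (ℤ ⧸ v.asIdeal)) :
    ∃ M : ℕ, W.conductorNorm ℤ = M * (p : ℕ) ^ 2 ∧ ¬ (p : ℕ) ∣ M ∧
      (W.quadraticTwist (((-1 : ℤ) ^ ((p : ℕ) / 2) * p : ℤ) : ℚ)).conductorNorm ℤ ∣ M * p := by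
  haveI := Fact.mk p.2
  have hp2 : (p : ℕ) ≠ 2 := by omega
  set d : ℤ := (-1 : ℤ) ^ ((p : ℕ) / 2) * p with hd
  have hd0 : (d : ℚ) ≠ 0 := by
    have : d ≠ 0 := mul_ne_zero (pow_ne_zero _ (by norm_num)) (by exact_mod_cast p.2.ne_zero)
    exact_mod_cast this
  set W' := W.quadraticTwist (d : ℚ) with hW'
  haveI : W'.IsElliptic := W.isElliptic_quadraticTwist hd0
  have hgen : ∀ q : Nat.Primes, natGenerator ((primesEquiv (R := ℤ)).symm q) = q := fun q ↦
    congrArg (fun q : Nat.Primes ↦ (q : ℕ)) ((primesEquiv (R := ℤ)).apply_symm_apply q)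
  set v₀ : HeightOneSpectrum ℤ := (primesEquiv (R := ℤ)).symm p with hv₀
  have hgen₀ : natGenerator v₀ = p := by rw [hv₀]; exact hgen p
  set N := W.conductorNorm ℤ with hN
  have hN0 : N ≠ 0 := (W.conductorNorm_pos_holds).ne'
  have hN'0 : W'.conductorNorm ℤ ≠ 0 := (W'.conductorNorm_pos_holds).ne'
  -- `f_p(E) = 2`, `N = M p²`, `p ∤ M`
  have hf2 : W.conductorExponent v₀ = 2 :=
    le_antisymm (W.conductorExponent_le_two_of_five_le_natGenerator_holds v₀ (by rw [hgen₀]; exact hp5))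
      ((two_le_conductorExponent_iff_holds v₀ W).mpr hadd)
  have hfacp : N.factorization p = 2 := by
    have h := factorization_conductorNorm_holds W v₀
    rwa [hgen₀, hf2] at h
  obtain ⟨M, hM⟩ : (p : ℕ) ^ 2 ∣ N := by rw [← hfacp]; exact Nat.ordProj_dvd N p
  have hNM : N = M * (p : ℕ) ^ 2 := by rw [hM, mul_comm]
  have hpM : ¬ (p : ℕ) ∣ M := by
    have h := Nat.not_dvd_ordCompl p.2 hN0
    rwa [hfacp, hM, Nat.mul_div_cancel_left _ (pow_pos p.2.pos 2)] at h
  have hM0 : M ≠ 0 := fun h ↦ hN0 (by rw [hNM, h, zero_mul])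
  have hMp0 : M * p ≠ 0 := mul_ne_zero hM0 p.2.ne_zero
  refine ⟨M, hNM, hpM, (Nat.factorization_le_iff_dvd hN'0 hMp0).mp (Finsupp.le_def.mpr fun q ↦ ?_)⟩
  -- compare the exponents of each prime `q`
  rw [Nat.factorization_mul hM0 p.2.ne_zero, Finsupp.add_apply]
  by_cases hq : q.Prime
  swap
  · rw [Nat.factorization_eq_zero_of_not_prime _ hq]; exact Nat.zero_le _
  set vq : HeightOneSpectrum ℤ := (primesEquiv (R := ℤ)).symm ⟨q, hq⟩ with hvq
  have hgenq : natGenerator vq = q := by rw [hvq]; exact hgen ⟨q, hq⟩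
  have hfq : (W'.conductorNorm ℤ).factorization q = W'.conductorExponent vq := by
    have h := factorization_conductorNorm_holds W' vq
    rwa [hgenq] at h
  rw [hfq]
  by_cases hqp : q = p
  · -- at `p`: `f_p(E') ≤ 1`
    subst hqp
    have hvq₀ : vq = v₀ := by rw [hvq, hv₀]; exact congrArg _ (Subtype.ext rfl)
    rw [p.2.factorization_self]
    have h1 : W'.conductorExponent vq ≤ 1 := by
      rw [hvq₀]
      rcases hasGoodReductionAt_or_hasMultiplicativeReductionAt_or_hasAdditiveReductionAt v₀ W' with
        hg | hm | ha
      · rw [(conductorExponent_eq_zero_iff_holds v₀ W').mpr hg]; exact zero_le_one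
      · rw [(conductorExponent_eq_one_iff_holds v₀ W').mpr hm]
      · exact absurd ha hsemi
    omega
  · -- at `q ≠ p`: same reduction type
    have hvqp : natGenerator vq ≠ p := by rwa [hgenq]
    obtain ⟨hg', hm', -⟩ := W.hasReductionAt_quadraticTwist_pStar_iff hp2 vq hvqp
    have hpq : (p : ℕ).factorization q = 0 := by
      rw [p.2.factorization, Finsupp.single_apply, if_neg (Ne.symm hqp)]
    rw [hpq, add_zero]
    have hMq : M.factorization q = N.factorization q := by
      rw [hNM, Nat.factorization_mul hM0 (pow_ne_zero _ p.2.ne_zero), Finsupp.add_apply,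
        Nat.factorization_pow, Finsupp.smul_apply, hpq, smul_zero, add_zero]
    have hfWq : N.factorization q = W.conductorExponent vq := by
      have h := factorization_conductorNorm_holds W vq
      rwa [hgenq] at h
    rw [hMq, hfWq]
    rcases hasGoodReductionAt_or_hasMultiplicativeReductionAt_or_hasAdditiveReductionAt vq W with
      hg | hm | ha
    · rw [(conductorExponent_eq_zero_iff_holds vq W').mpr (hg'.mpr hg)]; exact Nat.zero_le _
    · rw [(conductorExponent_eq_one_iff_holds vq W').mpr (hm'.mpr hm),
        (conductorExponent_eq_one_iff_holds vq W).mpr hm]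
    · have h3 := h23 vq ha
      rw [Literature.NumberTheory.EllipticCurves.Rat.ringChar_int_quotient_asIdeal vq, hgenq] at h3
      have hq4 : q ≠ 4 := by rintro rfl; exact absurd hq (by norm_num)
      have hq5 : 5 ≤ natGenerator vq := by rw [hgenq]; omega
      calc W'.conductorExponent vq ≤ 2 := W'.conductorExponent_le_two_of_five_le_natGenerator_holds vq hq5
        _ ≤ W.conductorExponent vq := (two_le_conductorExponent_iff_holds vq W).mpr ha

/-! ### Kellock–Dokchitser's Remark 2.2 at an additive prime of quadratic-twist type -/

/-- **`λ_p(f) = W_p(E)` at an additive prime `p ≥ 5` of quadratic-twist type, from the Modularity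
Theorem.** Let `E / ℚ` be elliptic with newform `f` (modularity datum `IsNewformOf`), with no additive
reduction at `2, 3`, and let `p ≥ 5` be a prime of additive reduction such that `E' = E^{(p*)}` is not
additive at `p`. Then `λ_p(f) = (−1/p) = W_p(E)`. Modular side: `N_E = M p²`, `p ∤ M`, the newform `f'`
of `E'` (Modularity for `E'`) has level `N_{E'} ∣ M p` (`conductorNorm_eq_mul_sq_of_twist`) and
`aₙ(f) = (n/p) aₙ(f')` (`cuspCoeff_eq_legendreSym_mul_cuspCoeff`), so `f` is the twist of `f'` by
`(·/p)` and `λ_p(f) = (−1/p)` (`atkinLehnerEigenvalueAt_eq_χ₄_of_cuspCoeff_eq`; Atkin–Lehner 1970 §6,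
Atkin–Li 1978 §3). Curve side: `W_p(E) = (−1/p)` (`localRootNumber_padic_eq_χ₄_of_twist`; Rohrlich 1993,
Prop. 2(iii),(iv)). [cite: KellockDokchitser2023, Rem. 2.2 and Thm. 2.3] [cite: AtkinLi1978, §3]
[cite: Rohrlich1993Compositio, Prop. 2] -/
theorem atkinLehnerEigenvalueAt_eq_localRootNumberAt_of_twist (hmod : exists_isNewformOf) [W.IsElliptic]
    [NeZero (W.conductorNorm ℤ)] {f : CuspForm (Gamma0 (W.conductorNorm ℤ)) 2} (hf : IsNewformOf W f)
    (p : Nat.Primes) (hp5 : 5 ≤ (p : ℕ)) (hadd : W.HasAdditiveReductionAt ((primesEquiv (R := ℤ)).symm p))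
    (hsemi : ¬ (W.quadraticTwist (((-1 : ℤ) ^ ((p : ℕ) / 2) * p : ℤ) : ℚ)).HasAdditiveReductionAt
      ((primesEquiv (R := ℤ)).symm p))
    (h23 : ∀ v : HeightOneSpectrum ℤ, W.HasAdditiveReductionAt v → 3 < ringChar (ℤ ⧸ v.asIdeal)) :
    atkinLehnerEigenvalueAt f p = (W.localRootNumberAt ((primesEquiv (R := ℤ)).symm p) : ℂ) := by
  haveI := Fact.mk p.2
  have hp2 : (p : ℕ) ≠ 2 := by omega
  obtain ⟨M, hNM, hpM, hN'⟩ := W.conductorNorm_eq_mul_sq_of_twist p hp5 hadd hsemi h23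
  set d : ℤ := (-1 : ℤ) ^ ((p : ℕ) / 2) * p with hd
  have hd0 : (d : ℚ) ≠ 0 := by
    have : d ≠ 0 := mul_ne_zero (pow_ne_zero _ (by norm_num)) (by exact_mod_cast p.2.ne_zero)
    exact_mod_cast this
  set W' := W.quadraticTwist (d : ℚ) with hW'
  haveI : W'.IsElliptic := W.isElliptic_quadraticTwist hd0
  haveI : NeZero (W'.conductorNorm ℤ) := ⟨(W'.conductorNorm_pos_holds).ne'⟩
  -- Modularity for `E'`
  obtain ⟨f', hf'⟩ := hmod W'
  -- modular side: `f = f' ⊗ (·/p)` and `λ_p(f) = (−1/p)`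
  set v : HeightOneSpectrum (𝓞 ℚ) := (primesEquiv (R := 𝓞 ℚ)).symm p with hv
  have hvp : (primesEquiv v : ℕ) = p := by rw [hv, Equiv.apply_symm_apply]
  have haddO : W.HasAdditiveReductionAt v := (W.hasAdditiveReductionAt_int_iff_ringOfIntegers p).mp hadd
  have hcoeff : ∀ n : ℕ, cuspCoeff f n = (legendreSym p n : ℂ) * cuspCoeff f' n :=
    W.cuspCoeff_eq_legendreSym_mul_cuspCoeff hp2 hvp haddO hf hf'
  have hf0 : f ≠ 0 := fun h0 ↦ hf.1.coe_ne_zero (by rw [h0]; rfl)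
  rw [atkinLehnerEigenvalueAt_eq_χ₄_of_cuspCoeff_eq hp2 hNM hpM hN' hf0 hcoeff,
    W.localRootNumberAt_primesEquiv_symm_eq (R := ℤ) p]
  -- curve side: `W_p(E) = (−1/p)`
  have hadd' : ((W.baseChange ℚ_[p]).minimal ℤ_[p]).HasAdditiveReduction ℤ_[p] :=
    (W.hasAdditiveReduction_padic_iff_hasAdditiveReductionAt_int p).mpr hadd
  have hsemi' : ¬ ((W'.baseChange ℚ_[p]).minimal ℤ_[p]).HasAdditiveReduction ℤ_[p] := fun h ↦
    hsemi ((W'.hasAdditiveReduction_padic_iff_hasAdditiveReductionAt_int p).mp h)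
  have hroot := W.localRootNumber_padic_eq_χ₄_of_twist hp5 hadd' hsemi'
  exact_mod_cast hroot.symm

/-- **`w(E) = −∏_p W_p(E)` from the Modularity Theorem alone, for curves whose additive primes are of
quadratic-twist type.** For an elliptic `W / ℚ` such that at every additive prime `p ≥ 5` the twist
`E^{(p*)}` is not additive, the named fact `W.rootNumber_eq_algebraicRootNumber` (whose own
hypothesis excludes additive reduction at `2, 3`) follows from `exists_isNewformOf` (BCDT 2001,
Thm. A) and nothing else: F1 = `atkinLehnerEigenvalueAt_eq_localRootNumberAt` holds at the
multiplicative primes (`atkinLehnerEigenvalueAt_eq_localRootNumberAt_of_not_sq_dvd`) and at the additive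
ones (`atkinLehnerEigenvalueAt_eq_localRootNumberAt_of_twist`), and the tree's
`rootNumber_eq_algebraicRootNumber_of_exists_isNewformOf_of_localRootNumberAt` concludes.
[cite: KellockDokchitser2023, Def. 2.1 and Rem. 2.2] [cite: BCDTJAMS2001, Theorem A] -/
theorem rootNumber_eq_algebraicRootNumber_of_exists_isNewformOf_of_twist (hmod : exists_isNewformOf)
    (htw : ∀ p : Nat.Primes, 5 ≤ (p : ℕ) → W.HasAdditiveReductionAt ((primesEquiv (R := ℤ)).symm p) →
      ¬ (W.quadraticTwist (((-1 : ℤ) ^ ((p : ℕ) / 2) * p : ℤ) : ℚ)).HasAdditiveReductionAt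
        ((primesEquiv (R := ℤ)).symm p)) :
    W.rootNumber_eq_algebraicRootNumber := by
  intro _ h23
  have hF1 : W.atkinLehnerEigenvalueAt_eq_localRootNumberAt := by
    intro _ _ f hf p hp _
    by_cases hsq : (p : ℕ) ^ 2 ∣ W.conductorNorm ℤ
    · have hN0 : W.conductorNorm ℤ ≠ 0 := (W.conductorNorm_pos_holds).ne'
      have hgen : natGenerator ((primesEquiv (R := ℤ)).symm p) = p :=
        congrArg (fun q : Nat.Primes ↦ (q : ℕ)) ((primesEquiv (R := ℤ)).apply_symm_apply p)
      have h2 : 2 ≤ W.conductorExponent ((primesEquiv (R := ℤ)).symm p) := by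
        rw [← factorization_conductorNorm_holds W ((primesEquiv (R := ℤ)).symm p), hgen]
        exact (p.2.pow_dvd_iff_le_factorization hN0).mp hsq
      have hadd := (two_le_conductorExponent_iff_holds _ W).mp h2
      have h3 := h23 _ hadd
      rw [Literature.NumberTheory.EllipticCurves.Rat.ringChar_int_quotient_asIdeal, hgen] at h3
      have hp4 : (p : ℕ) ≠ 4 := fun h ↦ absurd p.2 (by rw [h]; norm_num)
      have hp5 : 5 ≤ (p : ℕ) := by omega
      exact W.atkinLehnerEigenvalueAt_eq_localRootNumberAt_of_twist hmod hf p hp5 hadd (htw p hp5 hadd) h23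
    · exact W.atkinLehnerEigenvalueAt_eq_localRootNumberAt_of_not_sq_dvd hf p hp hsq
  exact W.rootNumber_eq_algebraicRootNumber_of_exists_isNewformOf_of_localRootNumberAt hmod hF1 h23

end WeierstrassCurve

end
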